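import Summits.BirchSwinnertonDyer.Rank1Residual.Additive.X4KimLargeImageIntegralPeriod
import Summits.BirchSwinnertonDyer.Rank1Residual.Additive.X4KimLargeImagePrimary
import Summits.BirchSwinnertonDyer.Rank1Residual.Additive.PlusSymbolIntegrality
import Summits.BirchSwinnertonDyer.Rank1Residual.X4.OptimalPeriod
import HarnessLib

/-!
# BSD rank-≤1 residual cell: the `Ω⁺_f`-integrality binder of the `Kim2025` own-currency records is
# a THEOREM on every tower row — the bridges of `X4KimLargeImageIntegralPeriod` / `…Primary` without `hint`

HONEST FRAMING (cell `b2b-bsdres-*`, run/shared/lean/b2b/bsd-rank1-residual/, verbatim): the goal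
of the cell is to DELETE the COMBINATION-SHAPED residual classes for ALL analytic-rank `≤ 1` elliptic
curves over `ℚ` — "full BSD formula for every rank `≤ 1` curve in class C" assembled STRICTLY from
published theorems — so that the rank-`≤ 1` remainder becomes exactly the CONSTRUCTION-SHAPED
classes, which are TYPED (missing-input Props), NOT attempted; this is not "finishing BSD".
Prove what is provable now; shrink each hard class to its core with data; no claim beyond stated
classes.  Research routes; census output = EVIDENCE, never a Literature fact.  Unit
`b2b-bsdres-n1011-p09` (team n1011, OWNERS rows T-a4 / **T-R18b**, ROUTE-1 R1-8 (ii)).  THEOREMS ONLY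
(no definition, no named fact, no instance).  N11 / O7 labels unchanged; nothing booked.  FLAG
`Kim2025-preprint` on EVERY theorem below taking a `Kim2025.…_OPEN` binder: each is CONDITIONAL on
the unrefereed arXiv:2505.09121v1 (its `p = 3` Kolyvagin-system input, Sakamoto JTNB 36 (2024), is
refereed); the `_OPEN` `Prop`s are explicit hypotheses, never theorems.

## What this file does

The own-currency records `Kim2025.cor17_rankZero_padicValNat_sha_le_of_integralPeriod_OPEN` (P2) /
`…_sha_eq_of_kuriharaNumber_ne_zero_of_integralPeriod_OPEN` and the primary
`Kim2025.thm11_kimShaLength_of_integralPeriod_OPEN` (P1) carry the binder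
`hint : ∀ r, ratPlusSymbol f r ≠ 0 → 0 ≤ padicValRat p (ratPlusSymbol f r)` ("`Ω⁺_f` is an integral
period of the plus symbols", Kim 2025 Def. 2.2 / Rem. 2.3), and so did every consumer bridge of the
gen-1 files `X4KimLargeImageIntegralPeriod` (RA3 (ii)/(iii)) and `X4KimLargeImagePrimary` (ONE-PRIMARY,
D1–D4).  By ROUTE-1 R1-8 (ii), now the KERNEL THEOREM
`Additive.forall_padicValRat_ratPlusSymbol_nonneg_of_towerSurj` (file `Additive/PlusSymbolIntegrality`:
Drinfeld's operator `T_ℓ − ℓ − 1` at every cusp + a non-Eisenstein prime `ℓ ≡ 1 (mod N)` from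
irreducibility, `p` odd), that binder HOLDS on every row the records speak about (`3 ≤ p`, tower ⇒
`surj(p)` ⇒ `E[p]` irreducible).  This file restates each bridge WITHOUT `hint`:

* `integralPeriod_of_towerSurj` — the binder itself, from `3 ≤ p`, the tower and `IsNewformOf W f`;
* `rankZero_padicValNat_sha_le_of_periodTransfer_OPEN`, `rankZero_padicValNat_shaOrder_le_of_periodTransfer_OPEN`,
  `X4RankZero.padicValNat_shaOrder_le_of_periodTransfer_OPEN` — P2 + period transfer ⟹ the
  `Ω(W)`-shape inequalities (what remains of the flag `Kim2025-OmegaE-integrality` is ONLY the period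
  transfer `Ω(W) = u·Ω⁺_f`, `|u|_p = 1`, i.e. the Manin-constant / lattice-index bit, discharged for
  optimal parametrisations with `p ∤ c` by the cell's `X4.periodTransfer_of_optimal`);
* `rankZero_padicValNat_sha_le_of_optimal_OPEN`, `X4RankZero.padicValNat_shaOrder_le_of_optimal_OPEN` —
  on an OPTIMAL parametrisation datum `D` with `p ∤ c` the period transfer is the cell's
  `X4.periodTransfer_of_optimal`, so the conclusion of the flagged `Ω(W)`-shaped record
  `Kim2025.rankZero_padicValNat_sha_le_of_towerSurj_OPEN` is DERIVED from P2 there with NO flag content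
  left (referee-1 ACK-1 T-a4 proviso 1: "the Ω(W) ones DERIVED");
* `bsdp_iff_not_dvd_tamagawaProduct_OPEN_of_kuriharaUnit`, `X4RankZero.bsdp_OPEN_of_kuriharaUnitAt` —
  the exact boundary / LOWER@3 per-pair certificate shape;
* `kimShaLengthAt_of_thm11_OPEN`, `kimShaLengthRankZeroAt_of_thm11_OPEN` — P1 ⟹ cc-typer-1's
  predicates (RA3 (iii));
* `cor17_le_of_thm11_OPEN`, `cor17_unit_of_thm11_OPEN`, `cor17_levelK_le_of_thm11_OPEN`,
  `rankOne_sha_val_eq_zero_of_thm11_OPEN` — D1–D4 of `X4KimLargeImagePrimary`;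
* `cor17_rankZero_le_of_OPEN` — P2 at `v = 0` with the integrality discharged: on every tower row
  with `L(E,1) ≠ 0`, `ord_p #Ш(E/ℚ)(p) ≤ ord_p [0]⁺_f`, CONDITIONAL only on the preprint.

## References

* C.-H. Kim (appendix with R. Pollack), *The refined Tamagawa number conjectures for GL₂*,
  arXiv:2505.09121v1, Thm. 1.1, Cor. 1.7, Def. 2.2, Rem. 2.3, §1.4.4 [Kim2025RefinedTNC] (ANNOUNCED;
  OPEN hypothesis, nothing asserted); R. Sakamoto, JTNB 36 (2024) Thm. 1.1 [Sakamoto2024KolyvaginThree].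
* C. Wuthrich, Doc. Math. 19 (2014) p. 382 [Wuthrich2014]; C.-H. Kim, AJM 148 §1.4.1 [Kim2026AJM]
  (the printed integrality statement, here a kernel theorem).
* Cell files: `cells/n1011/skel/T-R18b.md`; `cells/n1011/REFEREE-1.md` ACK-1 T-a4 (RA3, provisos 1–3);
  `HOME/b2b-bsdres-n1011-p09/KIM2025-READING.md` §6.
-/

noncomputable section

open scoped Classical MatrixGroups ModularForm

open CongruenceSubgroup WeierstrassCurve Literature.NumberTheory.EllipticCurves
  Literature.NumberTheory.EllipticCurves.ModularForms
  Literature.NumberTheory.EllipticCurves.Rank1Residual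
  Literature.NumberTheory.EllipticCurves.Rank1Residual.Typed

namespace Summit.BirchSwinnertonDyer.Rank1Residual.Additive

variable (W : WeierstrassCurve ℚ) [W.IsElliptic] [W.IsGloballyMinimal] (p : ℕ) [hp : Fact p.Prime]

/-! ### The binder, discharged -/

/-- **`Ω⁺_f` is an integral period on every tower row** (`3 ≤ p`, `ρ̄_{E,p^n}` onto for all `n`, `f`
the newform of `E`): `∀ r, [r]⁺_f ≠ 0 → 0 ≤ ord_p [r]⁺_f` — the `hint` binder of the `Kim2025`
own-currency records, by `forall_padicValRat_ratPlusSymbol_nonneg_of_towerSurj` (ROUTE-1 R1-8 (ii)).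
[folklore] -/
theorem integralPeriod_of_towerSurj (hp3 : 3 ≤ p)
    (htower : ∀ n : ℕ, W.HasSurjectiveModNGaloisRep (p ^ n : ℕ))
    {N : ℕ} [NeZero N] {f : CuspForm (Gamma0 N) 2} (hf : IsNewformOf W f) :
    ∀ r : ℚ, ratPlusSymbol f r ≠ 0 → 0 ≤ padicValRat p (ratPlusSymbol f r) :=
  forall_padicValRat_ratPlusSymbol_nonneg_of_towerSurj (by omega) hf htower

/-! ### P2 (own currency) + period transfer ⟹ the `Ω(W)` shapes, no integrality binder -/

/-- **[K25] Cor. 1.7 in its own currency (P2, OPEN) + period transfer ⟹ `L(E,1)/Ω(W) = q` with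
`ord_p #Ш(E/ℚ)(p) ≤ ord_p q`** — `rankZero_padicValNat_sha_le_of_integralPeriod_of_periodTransfer` with
the integrality binder DISCHARGED. CONDITIONAL on the preprint (flag `Kim2025-preprint`).
[claim: Kim2025RefinedTNC, status: under-review] [cite: Kim2025RefinedTNC, Cor. 1.7, §1.4.4, Rem. 2.3 (ANNOUNCED, OPEN binder)] -/
theorem rankZero_padicValNat_sha_le_of_periodTransfer_OPEN
    (hK25v : Kim2025.cor17_rankZero_padicValNat_sha_le_of_integralPeriod_OPEN)
    (hp3 : 3 ≤ p) (htower : ∀ n : ℕ, W.HasSurjectiveModNGaloisRep (p ^ n : ℕ))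
    (hL : W.entireLFunction 1 ≠ 0) (hfin : Finite W.sha)
    {N : ℕ} [NeZero N] {f : CuspForm (Gamma0 N) 2} (hf : IsNewformOf W f)
    (hper : ∃ u : ℚ, ‖(u : ℚ_[p])‖ = 1 ∧ W.realPeriodRat = u * plusPeriod f) :
    ∃ q : ℚ, W.entireLFunction 1 / (W.realPeriodRat : ℂ) = (q : ℂ) ∧
      (padicValNat p (Nat.card (AddCommGroup.primaryComponent W.sha p)) : ℤ) ≤ padicValRat p q :=
  rankZero_padicValNat_sha_le_of_integralPeriod_of_periodTransfer W p hK25v hp3 htower hL hfin hf hper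
    (integralPeriod_of_towerSurj W p hp3 htower hf)

/-- **`#Ш_an`-shape**: P2 (OPEN) + GZK + modularity + tower + period transfer ⟹ `#Ш_an = q` with
`ord_p #Ш ≤ ord_p q + ord_p ∏ c_ℓ − 2 ord_p #E(ℚ)_tors`; integrality binder DISCHARGED. CONDITIONAL
on the preprint. [claim: Kim2025RefinedTNC, status: under-review]
[cite: Kim2025RefinedTNC, Cor. 1.7 (ANNOUNCED, OPEN binder)] [cite: Miller2011LMS, Def. 1.1] -/
theorem rankZero_padicValNat_shaOrder_le_of_periodTransfer_OPEN
    (hK25v : Kim2025.cor17_rankZero_padicValNat_sha_le_of_integralPeriod_OPEN)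
    (hGZK : rank_eq_analyticRank_of_analyticRank_le_one) (hmod : hasEntireLFunction_rat)
    (hp3 : 3 ≤ p) (hr : W.analyticRank = 0)
    (htower : ∀ n : ℕ, W.HasSurjectiveModNGaloisRep (p ^ n : ℕ))
    {N : ℕ} [NeZero N] {f : CuspForm (Gamma0 N) 2} (hf : IsNewformOf W f)
    (hper : ∃ u : ℚ, ‖(u : ℚ_[p])‖ = 1 ∧ W.realPeriodRat = u * plusPeriod f) :
    ∃ q : ℚ, shaAn W = (q : ℂ) ∧
      (padicValNat p W.shaOrder : ℤ) ≤
        padicValRat p q + padicValNat p W.tamagawaProduct - 2 * padicValNat p W.torsionOrder :=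
  rankZero_padicValNat_shaOrder_le_of_integralPeriod_OPEN W p hK25v hGZK hmod hp3 hr htower hf hper
    (integralPeriod_of_towerSurj W p hp3 htower hf)

/-- **X4 ∧ `r_an = 0` ∧ tower ∧ period transfer ⟹ `ord_p #Ш ≤ ord_p #Ш_an + ord_p ∏ c_ℓ`** from P2
(OPEN), NO Manin datum, NO integrality binder. CONDITIONAL on the preprint.
[claim: Kim2025RefinedTNC, status: under-review] [cite: Kim2025RefinedTNC, Cor. 1.7 (ANNOUNCED, OPEN binder)] -/
theorem X4RankZero.padicValNat_shaOrder_le_of_periodTransfer_OPEN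
    (hK25v : Kim2025.cor17_rankZero_padicValNat_sha_le_of_integralPeriod_OPEN)
    (hGZK : rank_eq_analyticRank_of_analyticRank_le_one) (hmod : hasEntireLFunction_rat)
    (hr : W.analyticRank = 0) (hX : ClassX4 W p)
    (htower : ∀ n : ℕ, W.HasSurjectiveModNGaloisRep (p ^ n : ℕ))
    {N : ℕ} [NeZero N] {f : CuspForm (Gamma0 N) 2} (hf : IsNewformOf W f)
    (hper : ∃ u : ℚ, ‖(u : ℚ_[p])‖ = 1 ∧ W.realPeriodRat = u * plusPeriod f) :
    ∃ q : ℚ, shaAn W = (q : ℂ) ∧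
      (padicValNat p W.shaOrder : ℤ) ≤ padicValRat p q + padicValNat p W.tamagawaProduct := by
  have hp3 : 3 ≤ p := by
    have h2 := hp.out.two_le
    have hne : p ≠ 2 := hX.1
    omega
  exact X4RankZero.padicValNat_shaOrder_le_of_integralPeriod_OPEN W p hK25v hGZK hmod hr hX htower hf
    hper (integralPeriod_of_towerSurj W p hp3 htower hf)

/-! ### On OPTIMAL parametrisations: the `Ω(W)` shape DERIVED from P2, no flag content -/

/-- **P2 (OPEN) on an OPTIMAL parametrisation datum `D` with `p ∤ c_D` ⟹ `L(E,1)/Ω(W) = q` with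
`ord_p #Ш(E/ℚ)(p) ≤ ord_p q`** — the conclusion of the flagged `Ω(W)`-shaped record
`Kim2025.rankZero_padicValNat_sha_le_of_towerSurj_OPEN`, here DERIVED: the period transfer is
`X4.periodTransfer_of_optimal` (`Ω(W) = |c|·Ω⁺_{D.f}`, `p ∤ c`) and the integrality is
`integralPeriod_of_towerSurj`. CONDITIONAL only on the preprint clause `hK25v` (flag
`Kim2025-preprint`). [claim: Kim2025RefinedTNC, status: under-review]
[cite: Kim2025RefinedTNC, Cor. 1.7, §1.4.4, Rem. 2.3 (ANNOUNCED, OPEN binder)] [cite: GreenbergVatsal2000, §3, Remark 3.4] -/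
theorem rankZero_padicValNat_sha_le_of_optimal_OPEN
    (hK25v : Kim2025.cor17_rankZero_padicValNat_sha_le_of_integralPeriod_OPEN)
    (hp3 : 3 ≤ p) (htower : ∀ n : ℕ, W.HasSurjectiveModNGaloisRep (p ^ n : ℕ))
    (hL : W.entireLFunction 1 ≠ 0) (hfin : Finite W.sha)
    {N : ℕ} [NeZero N] (D : ModularParametrizationData W N)
    (hopt : ∀ z ∈ D.L.lattice, ∃ w ∈ periodLattice D.f, z = D.c * w)
    (hc : ¬ (p : ℤ) ∣ D.maninConstant) :
    ∃ q : ℚ, W.entireLFunction 1 / (W.realPeriodRat : ℂ) = (q : ℂ) ∧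
      (padicValNat p (Nat.card (AddCommGroup.primaryComponent W.sha p)) : ℤ) ≤ padicValRat p q :=
  rankZero_padicValNat_sha_le_of_periodTransfer_OPEN W p hK25v hp3 htower hL hfin D.isNewformOf
    (X4.periodTransfer_of_optimal p D hopt hc)

/-- **X4 ∧ `r_an = 0` ∧ tower ∧ OPTIMAL datum with `p ∤ c` ⟹ `ord_p #Ш ≤ ord_p #Ш_an + ord_p ∏ c_ℓ`**
from P2 (OPEN) — period transfer AND integrality both discharged. CONDITIONAL on the preprint.
[claim: Kim2025RefinedTNC, status: under-review] [cite: Kim2025RefinedTNC, Cor. 1.7 (ANNOUNCED, OPEN binder)] -/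
theorem X4RankZero.padicValNat_shaOrder_le_of_optimal_OPEN
    (hK25v : Kim2025.cor17_rankZero_padicValNat_sha_le_of_integralPeriod_OPEN)
    (hGZK : rank_eq_analyticRank_of_analyticRank_le_one) (hmod : hasEntireLFunction_rat)
    (hr : W.analyticRank = 0) (hX : ClassX4 W p)
    (htower : ∀ n : ℕ, W.HasSurjectiveModNGaloisRep (p ^ n : ℕ))
    {N : ℕ} [NeZero N] (D : ModularParametrizationData W N)
    (hopt : ∀ z ∈ D.L.lattice, ∃ w ∈ periodLattice D.f, z = D.c * w)
    (hc : ¬ (p : ℤ) ∣ D.maninConstant) :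
    ∃ q : ℚ, shaAn W = (q : ℂ) ∧
      (padicValNat p W.shaOrder : ℤ) ≤ padicValRat p q + padicValNat p W.tamagawaProduct :=
  X4RankZero.padicValNat_shaOrder_le_of_periodTransfer_OPEN W p hK25v hGZK hmod hr hX htower
    D.isNewformOf (X4.periodTransfer_of_optimal p D hopt hc)

/-! ### The unit form: the exact boundary, no integrality binder -/

/-- **The exact boundary `BSD(E,p) ⟺ p ∤ ∏ c_ℓ` from ONE unit Kurihara number in [K25]'s own currency
(OPEN) under the period transfer** — integrality binder DISCHARGED. Per pair; CONDITIONAL on the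
preprint. [claim: Kim2025RefinedTNC, status: under-review]
[cite: Kim2025RefinedTNC, Thm. 1.1 ("BSD"), Cor. 1.7 (ANNOUNCED, OPEN binder)] [cite: Miller2011LMS, Def. 1.1] -/
theorem bsdp_iff_not_dvd_tamagawaProduct_OPEN_of_kuriharaUnit
    (hK25u : Kim2025.cor17_rankZero_padicValRat_sha_eq_of_kuriharaNumber_ne_zero_of_integralPeriod_OPEN)
    (hGZK : rank_eq_analyticRank_of_analyticRank_le_one) (hp3 : 3 ≤ p)
    (htower : ∀ n : ℕ, W.HasSurjectiveModNGaloisRep (p ^ n : ℕ)) (hL : W.entireLFunction 1 ≠ 0)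
    {N : ℕ} [NeZero N] {f : CuspForm (Gamma0 N) 2} (hf : IsNewformOf W f)
    (hper : ∃ u : ℚ, ‖(u : ℚ_[p])‖ = 1 ∧ W.realPeriodRat = u * plusPeriod f)
    (n : ℕ) [NeZero n] (hn : Kato.IsKolyvaginProduct W p 1 n)
    (hcyc : ∀ (ℓ : ℕ) [Fact ℓ.Prime], ℓ ∣ n →
      Nat.card {P : ((WeierstrassCurve.integralModelInt W).map
          (Int.castRingHom (ZMod ℓ))).toAffine.Point // p • P = 0} ≤ p)
    (ψ : (ℓ : ℕ) → (ZMod ℓ)ˣ →* Multiplicative (ZMod (p ^ 1)))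
    (hψ : ∀ ℓ ∈ n.primeFactors, Function.Surjective (ψ ℓ))
    (hδ : kuriharaNumber f (p ^ 1) n ψ ≠ 0) : BSDp W p ↔ ¬ p ∣ W.tamagawaProduct :=
  bsdp_iff_not_dvd_tamagawaProduct_of_integralPeriod_OPEN_of_kuriharaUnit W p hK25u hGZK hp3 htower hL
    hf hper (integralPeriod_of_towerSurj W p hp3 htower hf) n hn hcyc ψ hψ hδ

/-- **X4 ∧ `r_an = 0` ∧ tower ∧ period transfer ∧ `p ∤ ∏ c_ℓ`: `BSD(E,p)` from ONE unit Kurihara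
number** (typed input `X4.KuriharaUnitAt W p f`) — the LOWER@3 per-pair certificate shape of N11 with
the integrality binder DISCHARGED. CONDITIONAL on the preprint. [claim: Kim2025RefinedTNC, status: under-review]
[cite: Kim2025RefinedTNC, Thm. 1.1, Cor. 1.7, §8.1.1 (ANNOUNCED, OPEN binder)] [cite: Miller2011LMS, Def. 1.1] -/
theorem X4RankZero.bsdp_OPEN_of_kuriharaUnitAt
    (hK25u : Kim2025.cor17_rankZero_padicValRat_sha_eq_of_kuriharaNumber_ne_zero_of_integralPeriod_OPEN)
    (hGZK : rank_eq_analyticRank_of_analyticRank_le_one) (hmod : hasEntireLFunction_rat)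
    (hr : W.analyticRank = 0) (hX : ClassX4 W p)
    (htower : ∀ n : ℕ, W.HasSurjectiveModNGaloisRep (p ^ n : ℕ))
    {N : ℕ} [NeZero N] {f : CuspForm (Gamma0 N) 2} (hf : IsNewformOf W f)
    (hper : ∃ u : ℚ, ‖(u : ℚ_[p])‖ = 1 ∧ W.realPeriodRat = u * plusPeriod f)
    (htam : ¬ p ∣ W.tamagawaProduct) (hK : X4.KuriharaUnitAt W p f) : BSDp W p := by
  have hp3 : 3 ≤ p := by
    have h2 := hp.out.two_le
    have hne : p ≠ 2 := hX.1
    omega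
  exact X4RankZero.bsdp_of_integralPeriod_OPEN_of_kuriharaUnitAt W p hK25u hGZK hmod hr hX htower hf
    hper (integralPeriod_of_towerSurj W p hp3 htower hf) htam hK

/-! ### P1 ⟹ cc-typer-1's predicates, no integrality binder (RA3 (iii)) -/

/-- **Kim 2025 Thm. 1.1 ("BSD") clause (P1, OPEN) ⟹ `X4.KimShaLengthAt W p f`** at `p ≥ 3` under the
tower, `Ш` finite, `f` the newform of `W` — integrality binder DISCHARGED. CONDITIONAL on the preprint.
[claim: Kim2025RefinedTNC, status: under-review] [cite: Kim2025RefinedTNC, Thm. 1.1 ("BSD") (ANNOUNCED, OPEN binder)] -/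
theorem kimShaLengthAt_of_thm11_OPEN
    (hK25s : Kim2025.thm11_kimShaLength_of_integralPeriod_OPEN)
    (hp3 : 3 ≤ p) (htower : ∀ n : ℕ, W.HasSurjectiveModNGaloisRep (p ^ n : ℕ)) (hfin : Finite W.sha)
    {N : ℕ} [NeZero N] {f : CuspForm (Gamma0 N) 2} (hf : IsNewformOf W f) :
    X4.KimShaLengthAt W p f :=
  kimShaLengthAt_of_kim2025_OPEN W p hK25s hp3 htower hfin hf
    (integralPeriod_of_towerSurj W p hp3 htower hf)

/-- **… and the BSD-currency reading in analytic rank `0`** for a modular parametrisation datum `D`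
under the period transfer: `X4.KimShaLengthRankZeroAt W p D.f` — integrality binder DISCHARGED.
CONDITIONAL on the preprint. [claim: Kim2025RefinedTNC, status: under-review]
[cite: Kim2025RefinedTNC, Thm. 1.1 ("BSD"), Cor. 1.7 (ANNOUNCED, OPEN binder)] -/
theorem kimShaLengthRankZeroAt_of_thm11_OPEN
    (hK25s : Kim2025.thm11_kimShaLength_of_integralPeriod_OPEN)
    (hp3 : 3 ≤ p) (htower : ∀ n : ℕ, W.HasSurjectiveModNGaloisRep (p ^ n : ℕ))
    (hL : W.entireLFunction 1 ≠ 0) (hfin : Finite W.sha)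
    {N : ℕ} [NeZero N] (D : ModularParametrizationData W N)
    (hper : ∃ u : ℚ, ‖(u : ℚ_[p])‖ = 1 ∧ W.realPeriodRat = u * plusPeriod D.f) :
    X4.KimShaLengthRankZeroAt W p D.f :=
  kimShaLengthRankZeroAt_of_kim2025_OPEN W p hK25s hp3 htower hL hfin D hper
    (integralPeriod_of_towerSurj W p hp3 htower D.isNewformOf)

/-! ### D1–D4 of `X4KimLargeImagePrimary`, no integrality binder -/

/-- **(D1) P1 (OPEN) ⟹ `ord_p #Ш(E/ℚ)(p) ≤ ord_p [0]⁺_f`** in analytic rank `0` on every tower row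
(`Ω⁺_f` IS an integral period: binder DISCHARGED). CONDITIONAL on the preprint.
[claim: Kim2025RefinedTNC, status: under-review] [cite: Kim2025RefinedTNC, Thm. 1.1 ("BSD"), Cor. 1.7 (ANNOUNCED, OPEN binder)] -/
theorem cor17_le_of_thm11_OPEN
    (hK25s : Kim2025.thm11_kimShaLength_of_integralPeriod_OPEN)
    (hp3 : 3 ≤ p) (htower : ∀ n : ℕ, W.HasSurjectiveModNGaloisRep (p ^ n : ℕ))
    (hL : W.entireLFunction 1 ≠ 0) (hfin : Finite W.sha)
    {N : ℕ} [NeZero N] {f : CuspForm (Gamma0 N) 2} (hf : IsNewformOf W f) :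
    (padicValNat p (Nat.card (AddCommGroup.primaryComponent W.sha p)) : ℤ) ≤
      padicValRat p (ratPlusSymbol f 0) :=
  cor17_le_at_integral_of_thm11 W p hK25s hp3 htower hL hfin hf
    (integralPeriod_of_towerSurj W p hp3 htower hf)

/-- **(D2) P1 (OPEN) ⟹ the unit clause `ord_p #Ш(E/ℚ)(p) = ord_p [0]⁺_f`** from ONE unit Kurihara
number at a cyclic level — integrality binder DISCHARGED. CONDITIONAL on the preprint.
[claim: Kim2025RefinedTNC, status: under-review] [cite: Kim2025RefinedTNC, Thm. 1.1 ("BSD"), Cor. 1.7 (ANNOUNCED, OPEN binder)] -/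
theorem cor17_unit_of_thm11_OPEN
    (hK25s : Kim2025.thm11_kimShaLength_of_integralPeriod_OPEN)
    (hp3 : 3 ≤ p) (htower : ∀ n : ℕ, W.HasSurjectiveModNGaloisRep (p ^ n : ℕ))
    (hL : W.entireLFunction 1 ≠ 0) (hfin : Finite W.sha)
    {N : ℕ} [NeZero N] {f : CuspForm (Gamma0 N) 2} (hf : IsNewformOf W f)
    (n : ℕ) [NeZero n] (hn : Kato.IsKolyvaginProduct W p 1 n)
    (hcyc : ∀ (ℓ : ℕ) [Fact ℓ.Prime], ℓ ∣ n →
      Nat.card {P : ((WeierstrassCurve.integralModelInt W).map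
          (Int.castRingHom (ZMod ℓ))).toAffine.Point // p • P = 0} ≤ p)
    (ψ : (ℓ : ℕ) → (ZMod ℓ)ˣ →* Multiplicative (ZMod (p ^ 1)))
    (hψ : ∀ ℓ ∈ n.primeFactors, Function.Surjective (ψ ℓ))
    (hδ : kuriharaNumber f (p ^ 1) n ψ ≠ 0) :
    (padicValNat p (Nat.card (AddCommGroup.primaryComponent W.sha p)) : ℤ) =
      padicValRat p (ratPlusSymbol f 0) :=
  cor17_unit_at_integral_of_thm11 W p hK25s hp3 htower hL hfin hf
    (integralPeriod_of_towerSurj W p hp3 htower hf) n hn hcyc ψ hψ hδ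

/-- **(D4) P1 (OPEN) ⟹ the level-`k` clause `ord_p [0]⁺_f − (k − 1) ≤ ord_p #Ш(E/ℚ)(p)`** from ONE
non-zero Kurihara number mod `p^k` at a cyclic level — integrality binder DISCHARGED (the DEF rows'
level-2 certificate shape, ROUTE-1 R1-6). CONDITIONAL on the preprint.
[claim: Kim2025RefinedTNC, status: under-review] [cite: Kim2025RefinedTNC, Thm. 1.1 ("BSD"), Cor. 1.7, §8.1.2 (ANNOUNCED, OPEN binder)] -/
theorem cor17_levelK_le_of_thm11_OPEN
    (hK25s : Kim2025.thm11_kimShaLength_of_integralPeriod_OPEN)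
    (hp3 : 3 ≤ p) (htower : ∀ n : ℕ, W.HasSurjectiveModNGaloisRep (p ^ n : ℕ))
    (hL : W.entireLFunction 1 ≠ 0) (hfin : Finite W.sha)
    {N : ℕ} [NeZero N] {f : CuspForm (Gamma0 N) 2} (hf : IsNewformOf W f)
    (k n : ℕ) [NeZero n] (hk : 1 ≤ k) (hn : Kato.IsKolyvaginProduct W p k n)
    (hcyc : ∀ (ℓ : ℕ) [Fact ℓ.Prime], ℓ ∣ n →
      Nat.card {P : ((WeierstrassCurve.integralModelInt W).map
          (Int.castRingHom (ZMod ℓ))).toAffine.Point // p • P = 0} ≤ p)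
    (ψ : (ℓ : ℕ) → (ZMod ℓ)ˣ →* Multiplicative (ZMod (p ^ k)))
    (hψ : ∀ ℓ ∈ n.primeFactors, Function.Surjective (ψ ℓ))
    (hδ : kuriharaNumber f (p ^ k) n ψ ≠ 0) :
    padicValRat p (ratPlusSymbol f 0) - ((k - 1 : ℕ) : ℤ) ≤
      (padicValNat p (Nat.card (AddCommGroup.primaryComponent W.sha p)) : ℤ) :=
  cor17_levelK_le_of_thm11 W p hK25s hp3 htower hL hfin hf
    (integralPeriod_of_towerSurj W p hp3 htower hf) k n hk hn hcyc ψ hψ hδ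

/-- **(D3) P1 (OPEN) ⟹ the rank-one clause `ord_p #Ш(E/ℚ)(p) = 0`** (`L(E,1) = 0`, a unit Kurihara
number at a Kolyvagin prime; O7 ∩ X4) — integrality binder DISCHARGED. CONDITIONAL on the preprint.
[claim: Kim2025RefinedTNC, status: under-review] [cite: Kim2025RefinedTNC, Thm. 1.1 (Str)/("BSD") (ANNOUNCED, OPEN binder)] -/
theorem rankOne_sha_val_eq_zero_of_thm11_OPEN
    (hK25s : Kim2025.thm11_kimShaLength_of_integralPeriod_OPEN)
    (hp3 : 3 ≤ p) (htower : ∀ n : ℕ, W.HasSurjectiveModNGaloisRep (p ^ n : ℕ))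
    (hL : W.entireLFunction 1 = 0) (hfin : Finite W.sha)
    {N : ℕ} [NeZero N] {f : CuspForm (Gamma0 N) 2} (hf : IsNewformOf W f)
    (ℓ : ℕ) [hℓ : Fact ℓ.Prime] (hℓK : Kato.IsKolyvaginPrime W p 1 ℓ)
    (hcyc : Nat.card {P : ((WeierstrassCurve.integralModelInt W).map
        (Int.castRingHom (ZMod ℓ))).toAffine.Point // p • P = 0} ≤ p)
    (ψ : (ℓ' : ℕ) → (ZMod ℓ')ˣ →* Multiplicative (ZMod (p ^ 1)))
    (hψ : Function.Surjective (ψ ℓ)) (hδ : kuriharaNumber f (p ^ 1) ℓ ψ ≠ 0) :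
    padicValNat p (Nat.card (AddCommGroup.primaryComponent W.sha p)) = 0 :=
  rankOne_sha_val_eq_zero_of_thm11 W p hK25s hp3 htower hL hfin hf
    (integralPeriod_of_towerSurj W p hp3 htower hf) ℓ hℓK hcyc ψ hψ hδ

/-! ### P2 at `v = 0`, integrality discharged -/

/-- **[K25] Cor. 1.7 in its own currency (P2, OPEN) at `v = 0`, UNCONDITIONALLY IN THE INTEGRALITY**:
on every tower row (`3 ≤ p`, `ρ̄_{E,p^n}` onto for all `n`) with `L(E,1) ≠ 0` and `Ш` finite, and `f`
the newform of `E`: `ord_p #Ш(E/ℚ)(p) ≤ ord_p [0]⁺_f = ord_p (L(E,1)/Ω⁺_f)`.  CONDITIONAL only on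
the preprint clause `hK25v` (flag `Kim2025-preprint`). [claim: Kim2025RefinedTNC, status: under-review]
[cite: Kim2025RefinedTNC, Cor. 1.7, §1.4.4, Def. 2.2, Rem. 2.3 (ANNOUNCED, OPEN binder)] -/
theorem cor17_rankZero_le_of_OPEN
    (hK25v : Kim2025.cor17_rankZero_padicValNat_sha_le_of_integralPeriod_OPEN)
    (hp3 : 3 ≤ p) (htower : ∀ n : ℕ, W.HasSurjectiveModNGaloisRep (p ^ n : ℕ))
    (hL : W.entireLFunction 1 ≠ 0) (hfin : Finite W.sha)
    {N : ℕ} [NeZero N] {f : CuspForm (Gamma0 N) 2} (hf : IsNewformOf W f) :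
    (padicValNat p (Nat.card (AddCommGroup.primaryComponent W.sha p)) : ℤ) ≤
      padicValRat p (ratPlusSymbol f 0) := by
  have h := hK25v W p hp3 htower hL hfin f hf 0
    (fun r hr ↦ integralPeriod_of_towerSurj W p hp3 htower hf r hr)
  simpa using h

end Summit.BirchSwinnertonDyer.Rank1Residual.Additive

end
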